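import Literature.NumberTheory.Automorphic.UnitaryGroupArchProjection
import HarnessLib

/-!
# The archimedean factor at a complex EMBEDDING: `archAtEmb τ : U(J)(E ⊗ ℝ) →* U(τ(J))(ℂ)`

Registry: pub-hodgecm MODEL-CONSTRUCTION sub-cell, EMB-INSTANCE chain link (4) ("arch junction"), automorphic lane
(node D1-aut-ix-b, part 1 of 2; companion of `UnitaryGroupArchProjection`, D1-aut-ix). Everything is proved (kernel);
no named facts.

The automorphic lane indexes archimedean factors by complex PLACES `w` and reads coordinates through Mathlib's
`w.embedding`; a ball-quotient datum fixes a complex EMBEDDING `τ₁` and the real group `U(τ₁(H)) ≤ GL₃(ℂ)`. Mathlib only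
gives `(mk τ).embedding = τ ∨ (mk τ).embedding = conj ∘ τ` (`InfinitePlace.embedding_mk_eq`), and `U((conj ∘ τ)(J))` is the
entrywise conjugate of `U(τ(J))`, not equal to it — so a junction phrased with `w.embedding` may be off by a complex
conjugation. This file builds the archimedean factor AT THE EMBEDDING, removing the ambiguity:
* § 1 `evalEmb τ : E ⊗ ℝ →+* ℂ` (the `mk τ`-coordinate, followed by `conj` iff `(mk τ).embedding ≠ τ`):
  `evalEmb_mixedEmbedding : evalEmb τ (x ⊗ 1) = τ x`, `evalEmb_conjMixed`, continuity, `archFormOf_map_evalEmb`.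
* § 2 **`archAtEmb τ : U(J)(E ⊗ ℝ) →* unitaryGroupOfForm ⋆ (J.map τ)`** (restriction of `GL_N(evalEmb τ)`):
  `coe_archAtEmb_rationalToArch : archAtEmb τ (γ ⊗ 1) = GL_N(τ) γ`, continuity, `ker_archAtEmb = ker (archAt (mk τ))`,
  surjective, open, compact kernel under definiteness at the places `≠ mk τ` (transported from D1-aut-ix / U2-vi through
  entrywise `conj` on `GL_N(ℂ)` in the second case of `embedding_mk_eq`).
Part 2 (`UnitaryGroupArchProjectionEmb`) composes with a frame to `U(2,1)`.
References for the objects: Platonov–Rapinchuk 1994 §2.3, §3.2; Borel–Jacquet 1979 §4.1.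
-/

set_option autoImplicit false

noncomputable section

open NumberField NumberField.InfinitePlace Topology

open scoped Matrix MatrixGroups ComplexConjugate ComplexOrder

namespace Literature.NumberTheory.Automorphic

namespace UnitaryGroup

open NumberField.mixedEmbedding Literature.Geometry.ComplexHyperbolic Literature.Geometry.ComplexHyperbolic.BallModel

variable (F E : Type) [Field F] [NumberField F] [Field E] [NumberField E] [Algebra F E]
  (c : E ≃ₐ[F] E) (N : ℕ) (J : Matrix (Fin N) (Fin N) E)

/-! ## § 1. Evaluation of `E ⊗ ℝ` at a complex embedding -/

section EvalEmb

variable (τ : E →+* ℂ) (hτ : IsComplex (InfinitePlace.mk τ))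

/-- The complex place of the embedding `τ`, as an index of the complex coordinates of `E ⊗ ℝ`. [folklore] -/
abbrev placeOf : {w : InfinitePlace E // IsComplex w} := ⟨InfinitePlace.mk τ, hτ⟩

omit [NumberField E] in
open Classical in
/-- **Evaluation of `E ⊗ ℝ` at the complex embedding `τ`**: the `mk τ`-coordinate, composed with complex conjugation
iff Mathlib's chosen `(mk τ).embedding` is the conjugate of `τ` (`embedding_mk_eq`). [folklore] -/
def evalEmb : mixedSpace E →+* ℂ :=
  if (InfinitePlace.mk τ).embedding = τ then evalC E (placeOf E τ hτ)
  else (starRingEnd ℂ).comp (evalC E (placeOf E τ hτ))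

omit [NumberField E] in
/-- `evalEmb τ x = x_{mk τ}` when `(mk τ).embedding = τ`. [folklore] -/
theorem evalEmb_apply_of_eq (h : (InfinitePlace.mk τ).embedding = τ) (x : mixedSpace E) :
    evalEmb E τ hτ x = x.2 (placeOf E τ hτ) := by
  rw [evalEmb, if_pos h, evalC_apply]

omit [NumberField E] in
/-- `evalEmb τ x = conj x_{mk τ}` when `(mk τ).embedding ≠ τ`. [folklore] -/
theorem evalEmb_apply_of_ne (h : (InfinitePlace.mk τ).embedding ≠ τ) (x : mixedSpace E) :
    evalEmb E τ hτ x = starRingEnd ℂ (x.2 (placeOf E τ hτ)) := by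
  rw [evalEmb, if_neg h, RingHom.comp_apply, evalC_apply]

omit [NumberField E] in
/-- In the second case `(mk τ).embedding = conj ∘ τ`. [folklore] -/
theorem embedding_mk_eq_conjugate_of_ne (h : (InfinitePlace.mk τ).embedding ≠ τ) :
    (InfinitePlace.mk τ).embedding = ComplexEmbedding.conjugate τ :=
  (embedding_mk_eq τ).resolve_left h

omit [NumberField E] in
/-- **`evalEmb τ (x ⊗ 1) = τ x`** — in both cases. [folklore] -/
theorem evalEmb_mixedEmbedding (x : E) : evalEmb E τ hτ (mixedEmbedding E x) = τ x := by
  by_cases h : (InfinitePlace.mk τ).embedding = τ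
  · rw [evalEmb_apply_of_eq E τ hτ h, mixedEmbedding_apply_isComplex]
    exact congrFun (congrArg DFunLike.coe h) x
  · rw [evalEmb_apply_of_ne E τ hτ h, mixedEmbedding_apply_isComplex]
    change starRingEnd ℂ ((InfinitePlace.mk τ).embedding x) = τ x
    rw [embedding_mk_eq_conjugate_of_ne E τ h, ComplexEmbedding.conjugate_coe_eq, Complex.conj_conj]

omit [NumberField E] in
/-- `evalEmb τ` is continuous. [folklore] -/
theorem continuous_evalEmb : Continuous (evalEmb E τ hτ) := by
  by_cases h : (InfinitePlace.mk τ).embedding = τ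
  · rw [evalEmb, if_pos h]; exact continuous_evalC E _
  · rw [evalEmb, if_neg h]; exact Complex.continuous_conj.comp (continuous_evalC E _)

omit [NumberField F] [NumberField E] in
/-- At a place fixed by `c ≠ 1`, `evalEmb τ` intertwines `c ⊗ 1` with complex conjugation (U2-iii `evalC_conjMixed`).
[folklore] -/
theorem evalEmb_conjMixed (hw : c • InfinitePlace.mk τ = InfinitePlace.mk τ) (hc : c ≠ 1) (x : mixedSpace E) :
    evalEmb E τ hτ (conjMixed F E c x) = starRingEnd ℂ (evalEmb E τ hτ x) := by
  by_cases h : (InfinitePlace.mk τ).embedding = τ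
  · rw [evalEmb_apply_of_eq E τ hτ h, evalEmb_apply_of_eq E τ hτ h]
    exact evalC_conjMixed F E c (w := placeOf E τ hτ) hw hc x
  · rw [evalEmb_apply_of_ne E τ hτ h, evalEmb_apply_of_ne E τ hτ h]
    exact congrArg (starRingEnd ℂ) (evalC_conjMixed F E c (w := placeOf E τ hτ) hw hc x)

omit [NumberField E] in
/-- **`(J ⊗ 1).map (evalEmb τ) = τ(J)`**. [folklore] -/
theorem archFormOf_map_evalEmb : (archFormOf E N J).map (evalEmb E τ hτ) = J.map τ := by
  ext i j
  exact evalEmb_mixedEmbedding E τ hτ (J i j)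

end EvalEmb

/-! ## § 2. `archAtEmb τ : U(J)(E ⊗ ℝ) →* U(τ(J))(ℂ)` -/

section ArchAtEmb

variable (τ : E →+* ℂ) (hτ : IsComplex (InfinitePlace.mk τ))
  (hw : c • InfinitePlace.mk τ = InfinitePlace.mk τ) (hc : c ≠ 1)

omit [NumberField F] [NumberField E] in
/-- **The `τ`-component `U(J)(E ⊗ ℝ) →* U(τ(J))(ℂ) = unitaryGroupOfForm ⋆ (J.map τ)`** at a complex embedding `τ`
whose place is fixed by `c ≠ 1` (restriction of `GL_N(evalEmb τ)`). [cite: BorelJacquet1979, §4.1] -/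
def archAtEmb : arch F E c N J →* unitaryGroupOfForm (starRingEnd ℂ) (J.map τ) :=
  (((Matrix.GeneralLinearGroup.map (evalEmb E τ hτ)).restrict (arch F E c N J))).codRestrict _ fun g => by
    have h := map_mem_unitaryGroupOfForm (σ := conjMixed F E c) (τ := starRingEnd ℂ) (evalEmb E τ hτ)
      (evalEmb_conjMixed F E c τ hτ hw hc) g.2
    rw [archFormOf_map_evalEmb] at h
    exact h

omit [NumberField F] [NumberField E] in
/-- `archAtEmb τ g = GL_N(evalEmb τ) g` on underlying invertible matrices. [folklore] -/
@[simp] theorem coe_archAtEmb (g : arch F E c N J) :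
    ((archAtEmb F E c N J τ hτ hw hc g : unitaryGroupOfForm (starRingEnd ℂ) (J.map τ)) : GL (Fin N) ℂ) =
      Matrix.GeneralLinearGroup.map (evalEmb E τ hτ) (g : GL (Fin N) (mixedSpace E)) :=
  rfl

omit [NumberField F] [NumberField E] in
/-- Entries of `archAtEmb τ g`: `evalEmb τ (g_{ij})`. [folklore] -/
theorem coe_archAtEmb_apply (g : arch F E c N J) (i j : Fin N) :
    ((((archAtEmb F E c N J τ hτ hw hc g : unitaryGroupOfForm (starRingEnd ℂ) (J.map τ)) : GL (Fin N) ℂ) :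
        Matrix (Fin N) (Fin N) ℂ) i j) =
      evalEmb E τ hτ ((((g : GL (Fin N) (mixedSpace E)) : Matrix (Fin N) (Fin N) (mixedSpace E)) i j)) :=
  rfl

omit [NumberField F] [NumberField E] in
/-- **On rational points: `archAtEmb τ (γ ⊗ 1) = GL_N(τ) γ`** — no conjugation ambiguity. [folklore] -/
@[simp] theorem coe_archAtEmb_rationalToArch (γ : rational F E c N J) :
    ((archAtEmb F E c N J τ hτ hw hc (rationalToArch F E c N J γ) : unitaryGroupOfForm (starRingEnd ℂ) (J.map τ)) :
        GL (Fin N) ℂ) = Matrix.GeneralLinearGroup.map τ (γ : GL (Fin N) E) :=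
  Units.ext <| Matrix.ext fun _ _ => evalEmb_mixedEmbedding E τ hτ _

omit [NumberField F] [NumberField E] in
/-- `archAtEmb τ` is continuous. [folklore] -/
theorem continuous_archAtEmb : Continuous (archAtEmb F E c N J τ hτ hw hc) :=
  (((continuous_evalEmb E τ hτ).generalLinearGroup_map :
      Continuous (Matrix.GeneralLinearGroup.map (n := Fin N) (evalEmb E τ hτ))).comp continuous_subtype_val).subtype_mk _

omit [NumberField F] [NumberField E] in
/-- First case: `archAtEmb τ g = archAt (mk τ) g` on matrices when `(mk τ).embedding = τ`. [folklore] -/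
theorem coe_archAtEmb_of_eq (h : (InfinitePlace.mk τ).embedding = τ) (g : arch F E c N J) :
    ((archAtEmb F E c N J τ hτ hw hc g : unitaryGroupOfForm (starRingEnd ℂ) (J.map τ)) : GL (Fin N) ℂ) =
      (archAt F E c N J (placeOf E τ hτ) hw hc g : archLocal E N J (placeOf E τ hτ)) :=
  Units.ext <| Matrix.ext fun i j => by
    rw [coe_archAtEmb_apply, coe_archAt_apply, evalEmb_apply_of_eq E τ hτ h]

omit [NumberField F] [NumberField E] in
/-- Second case: `archAtEmb τ g = conj (archAt (mk τ) g)` (entrywise) when `(mk τ).embedding ≠ τ`. [folklore] -/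
theorem coe_archAtEmb_of_ne (h : (InfinitePlace.mk τ).embedding ≠ τ) (g : arch F E c N J) :
    ((archAtEmb F E c N J τ hτ hw hc g : unitaryGroupOfForm (starRingEnd ℂ) (J.map τ)) : GL (Fin N) ℂ) =
      Matrix.GeneralLinearGroup.map (starRingEnd ℂ)
        ((archAt F E c N J (placeOf E τ hτ) hw hc g : archLocal E N J (placeOf E τ hτ)) : GL (Fin N) ℂ) :=
  Units.ext <| Matrix.ext fun i j => by
    rw [coe_archAtEmb_apply, evalEmb_apply_of_ne E τ hτ h]
    rfl

omit [NumberField F] [NumberField E] in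
/-- Entrywise conjugation on `GL_N(ℂ)` is injective (it is an involution). [folklore] -/
theorem generalLinearGroup_map_conj_injective :
    Function.Injective (Matrix.GeneralLinearGroup.map (n := Fin N) (starRingEnd ℂ)) := fun a b hab =>
  Units.ext <| Matrix.ext fun i j => by
    have h := congrFun (congrFun (congrArg (fun u : GL (Fin N) ℂ => (u : Matrix (Fin N) (Fin N) ℂ)) hab) i) j
    exact (starRingEnd ℂ).injective h

omit [NumberField F] [NumberField E] in
/-- **`ker (archAtEmb τ) = ker (archAt (mk τ))`**. [folklore] -/
theorem ker_archAtEmb :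
    (archAtEmb F E c N J τ hτ hw hc).ker = (archAt F E c N J (placeOf E τ hτ) hw hc).ker := by
  ext g
  rw [MonoidHom.mem_ker, MonoidHom.mem_ker, ← Subtype.coe_inj, ← Subtype.coe_inj, OneMemClass.coe_one,
    OneMemClass.coe_one]
  by_cases h : (InfinitePlace.mk τ).embedding = τ
  · rw [coe_archAtEmb_of_eq F E c N J τ hτ hw hc h]
  · rw [coe_archAtEmb_of_ne F E c N J τ hτ hw hc h]
    constructor
    · intro h1
      apply generalLinearGroup_map_conj_injective N
      rw [h1, map_one]
    · intro h1
      rw [h1, map_one]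

omit [NumberField F] [NumberField E] in
/-- Entrywise conjugation maps `U(conj H)` into `U(H)`'s conjugate: `g ∈ U(⋆, H.map conj) → conj g ∈ U(⋆, H)`. [folklore] -/
theorem map_conj_mem_unitaryGroupOfForm {H : Matrix (Fin N) (Fin N) ℂ} {g : GL (Fin N) ℂ}
    (hg : g ∈ unitaryGroupOfForm (starRingEnd ℂ) (H.map (starRingEnd ℂ))) :
    Matrix.GeneralLinearGroup.map (starRingEnd ℂ) g ∈ unitaryGroupOfForm (starRingEnd ℂ) H := by
  have h := map_mem_unitaryGroupOfForm (σ := starRingEnd ℂ) (τ := starRingEnd ℂ) (starRingEnd ℂ)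
    (fun _ => rfl) hg
  rwa [Matrix.map_map, show (⇑(starRingEnd ℂ) ∘ ⇑(starRingEnd ℂ) : ℂ → ℂ) = id from
    funext Complex.conj_conj, Matrix.map_id] at h

omit [NumberField F] [NumberField E] in
/-- In the second case `σ_{mk τ}(J) = conj (τ(J))`. [folklore] -/
theorem map_embedding_eq_map_conj_of_ne (h : (InfinitePlace.mk τ).embedding ≠ τ) :
    J.map (placeOf E τ hτ).1.embedding = (J.map τ).map (starRingEnd ℂ) := by
  rw [Matrix.map_map]
  change J.map (InfinitePlace.mk τ).embedding = _
  rw [embedding_mk_eq_conjugate_of_ne E τ h]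
  exact congrArg J.map (funext fun x => ComplexEmbedding.conjugate_coe_eq τ x)

variable (hfix : ∀ w : InfinitePlace E, c • w = w)

omit [NumberField F] [NumberField E] in
include hfix in
/-- **`archAtEmb τ` is surjective** (when `c ≠ 1` fixes every infinite place). [folklore] -/
theorem archAtEmb_surjective : Function.Surjective (archAtEmb F E c N J τ hτ (hfix _) hc) := fun u => by
  by_cases h : (InfinitePlace.mk τ).embedding = τ
  · have hu : (u : GL (Fin N) ℂ) ∈ archLocal E N J (placeOf E τ hτ) := by
      change (u : GL (Fin N) ℂ) ∈ unitaryGroupOfForm (starRingEnd ℂ) (J.map (InfinitePlace.mk τ).embedding)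
      rw [h]; exact u.2
    obtain ⟨g, hg⟩ := archAt_surjective F E c N J hc hfix (placeOf E τ hτ) ⟨u, hu⟩
    refine ⟨g, Subtype.ext ?_⟩
    rw [coe_archAtEmb_of_eq F E c N J τ hτ (hfix _) hc h, hg]
  · have hu : Matrix.GeneralLinearGroup.map (starRingEnd ℂ) (u : GL (Fin N) ℂ) ∈ archLocal E N J (placeOf E τ hτ) := by
      change _ ∈ unitaryGroupOfForm (starRingEnd ℂ) (J.map (placeOf E τ hτ).1.embedding)
      rw [map_embedding_eq_map_conj_of_ne E N J τ hτ h]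
      exact map_mem_unitaryGroupOfForm (σ := starRingEnd ℂ) (τ := starRingEnd ℂ) (starRingEnd ℂ) (fun _ => rfl) u.2
    obtain ⟨g, hg⟩ := archAt_surjective F E c N J hc hfix (placeOf E τ hτ) ⟨_, hu⟩
    refine ⟨g, Subtype.ext ?_⟩
    rw [coe_archAtEmb_of_ne F E c N J τ hτ (hfix _) hc h, hg]
    exact Units.ext <| Matrix.ext fun i j => Complex.conj_conj _

omit [NumberField F] [NumberField E] in
include hfix in
/-- **`archAtEmb τ` is an open map** (when `c ≠ 1` fixes every infinite place): it is `archAt (mk τ)` followed by the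
identity or by entrywise conjugation, both homeomorphisms of `GL_N(ℂ)`. [folklore] -/
theorem isOpenMap_archAtEmb : IsOpenMap (archAtEmb F E c N J τ hτ (hfix _) hc) := by
  -- reduce to openness of the composite into `GL_N(ℂ)` restricted to its (closed-embedded) image
  have hopen := isOpenMap_archAt F E c N J hc hfix (placeOf E τ hτ)
  by_cases h : (InfinitePlace.mk τ).embedding = τ
  · have hJ : archLocal E N J (placeOf E τ hτ) = unitaryGroupOfForm (starRingEnd ℂ) (J.map τ) := by
      change unitaryGroupOfForm (starRingEnd ℂ) (J.map (InfinitePlace.mk τ).embedding) = _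
      rw [h]
    have hfac : (archAtEmb F E c N J τ hτ (hfix _) hc : arch F E c N J → unitaryGroupOfForm (starRingEnd ℂ) (J.map τ)) =
        subgroupCongrTop hJ ∘ archAt F E c N J (placeOf E τ hτ) (hfix _) hc := by
      funext g
      exact Subtype.ext (coe_archAtEmb_of_eq F E c N J τ hτ (hfix _) hc h g)
    rw [hfac]
    exact (subgroupCongrTop hJ).toHomeomorph.isOpenMap.comp hopen
  · -- second case: transport through entrywise conjugation, a self-homeomorphism of `GL_N(ℂ)`
    have hto : ∀ {g : GL (Fin N) ℂ}, g ∈ archLocal E N J (placeOf E τ hτ) →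
        Matrix.GeneralLinearGroup.map (starRingEnd ℂ) g ∈ unitaryGroupOfForm (starRingEnd ℂ) (J.map τ) := by
      intro g hg
      have hg' : g ∈ unitaryGroupOfForm (starRingEnd ℂ) ((J.map τ).map (starRingEnd ℂ)) := by
        rw [← map_embedding_eq_map_conj_of_ne E N J τ hτ h]; exact hg
      exact map_conj_mem_unitaryGroupOfForm N hg'
    have hfrom : ∀ {u : GL (Fin N) ℂ}, u ∈ unitaryGroupOfForm (starRingEnd ℂ) (J.map τ) →
        Matrix.GeneralLinearGroup.map (starRingEnd ℂ) u ∈ archLocal E N J (placeOf E τ hτ) := by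
      intro u hu
      change _ ∈ unitaryGroupOfForm (starRingEnd ℂ) (J.map (placeOf E τ hτ).1.embedding)
      rw [map_embedding_eq_map_conj_of_ne E N J τ hτ h]
      exact map_mem_unitaryGroupOfForm (σ := starRingEnd ℂ) (τ := starRingEnd ℂ) (starRingEnd ℂ) (fun _ => rfl) hu
    have hcont : Continuous (Matrix.GeneralLinearGroup.map (n := Fin N) (starRingEnd ℂ)) :=
      Complex.continuous_conj.generalLinearGroup_map
    let Φ : archLocal E N J (placeOf E τ hτ) ≃ₜ unitaryGroupOfForm (starRingEnd ℂ) (J.map τ) :=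
      { toFun := fun g => ⟨Matrix.GeneralLinearGroup.map (starRingEnd ℂ) (g : GL (Fin N) ℂ), hto g.2⟩
        invFun := fun u => ⟨Matrix.GeneralLinearGroup.map (starRingEnd ℂ) (u : GL (Fin N) ℂ), hfrom u.2⟩
        left_inv := fun _ => Subtype.ext (Units.ext <| Matrix.ext fun _ _ => Complex.conj_conj _)
        right_inv := fun _ => Subtype.ext (Units.ext <| Matrix.ext fun _ _ => Complex.conj_conj _)
        continuous_toFun := (hcont.comp continuous_subtype_val).subtype_mk _
        continuous_invFun := (hcont.comp continuous_subtype_val).subtype_mk _ }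
    have hfac : (archAtEmb F E c N J τ hτ (hfix _) hc : arch F E c N J → unitaryGroupOfForm (starRingEnd ℂ) (J.map τ)) =
        Φ ∘ archAt F E c N J (placeOf E τ hτ) (hfix _) hc := by
      funext g
      exact Subtype.ext (coe_archAtEmb_of_ne F E c N J τ hτ (hfix _) hc h g)
    rw [hfac]
    exact Φ.isOpenMap.comp hopen

omit [NumberField F] [NumberField E] in
include hfix in
/-- **The kernel of `archAtEmb τ` is compact when `σ_w(J)` is definite at every place `w ≠ mk τ`**
(`isCompact_ker_archAt`, D1-aut-ix). [cite: PlatonovRapinchuk1994, §3.2 Thm 3.1] -/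
theorem isCompact_ker_archAtEmb
    (hdef : ∀ w : {w : InfinitePlace E // IsComplex w}, w ≠ placeOf E τ hτ →
      (J.map w.1.embedding).PosDef ∨ (-J.map w.1.embedding).PosDef) :
    IsCompact ((archAtEmb F E c N J τ hτ (hfix _) hc).ker : Set (arch F E c N J)) := by
  rw [ker_archAtEmb]
  exact isCompact_ker_archAt F E c N J hc hfix (placeOf E τ hτ) hdef

end ArchAtEmb

end UnitaryGroup

end Literature.NumberTheory.Automorphic

end
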